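import Summits.BirchSwinnertonDyer.BirchSwinnertonDyer.Theorems.AdditiveKolyvaginRoadKolyvaginPrimitiveOfIndexLowerBoundConverse
import Summits.BirchSwinnertonDyer.BirchSwinnertonDyer.Theorems.AdditiveKolyvaginRoadKolyvaginPrimitiveSelfCertificate
import Literature.NumberTheory.EllipticCurves.SelmerCountShaTorsionProofs
import HarnessLib

/-!
# Route `AdditiveKolyvaginRoad`, crux r2 `KolyvaginPrimitiveAdditive` (KPA′, stmt-BirchSwinnertonDyer-21400), line `birth` v11:
# THE PINNED RANK-ONE STUB R1 IS NOT STRONGER THAN THE CRUX, modulo the published inputs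

Lead prover `bsd-wall-akr-p1` g8 (cell `pub/bsd-wall`); `--supports stmt-BirchSwinnertonDyer-21400` (bookkeeping for the registry of
record, skeleton `Cruxes/KolyvaginPrimitiveAdditive/Lines/birth.lean` v11: stubs P ∕ R1 ∕ R3 with `KPA′ ⟸ P ∧ R1 ∧ R3` input-free).

WHY. Stub R3 (`stub_higherSelmerRankAboveBottomAdditive`) is a restriction of the crux, but stub R1 (`stub_selmerRankOnePinnedAdditive`:
at a ♯ frame with `#Sel_p(E/K) = p`, SOME conductor-1 Kolyvagin–Heegner datum has `c₁(1) ≠ 0`) PINS the witness level `n = 1` and is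
therefore not a λ-term of the crux. This file shows it is nevertheless implied by the crux GRANTED THE PUBLISHED INPUTS the route already
carries (`PublishedInputsAdditiveKoly`, item 20137: Gross–Zagier, Kolyvagin, modularity, McCallum's Cor. 5.6 certificate half) — so the
rank split of v11 is EXACT modulo PUB: `KPA′ ⟸ P ∧ R1 ∧ R3` (skeleton, no input) and `PUB → (KPA′ → R1 ∧ R3)` (this file + restriction).

WHAT (one frame, then the route-level dress):
* `heegnerPoint_not_pDiv_of_selmerCard_eq_of_kolyvaginClass_ne_zero` — at a ♯ frame with `#Sel_p(E/K) = p`, if SOME Kolyvagin–Heegner datum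
  of Kolyvagin-prime support has `c₁(n) ≠ 0`, then the Heegner point `y_K` is not `p`-divisible in `E(K)`. Proof: the non-zero class is a
  McCallum certificate at exponent `0`, whence the Heegner-index lower bound `2·ord_p [E(K) : ℤ y_K] ≤ ord_p #Ш(E/K) + 2·ord_p ∏ c_ℓ`
  (akr-p2x-w2's `indexLowerBoundAt_of_exists_kolyvaginClass_ne_zero`, p620657); `rank E(K) = 1`, `Ш(E/K)` finite (Kolyvagin, given
  Gross–Zagier: `y_K` of infinite order) and `E(K)[p] = 0` (`ρ̄` onto) turn `#Sel_p(E/K) = p` into `Ш(E/K)[p] = 0` by the exact descent count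
  (`sha_torsion_eq_zero_of_natCard_selmerGroup_eq`, AEC X.4.2), so `p ∤ #Ш(E/K)` (Cauchy) and, with `p ∤ ∏ c_ℓ`, `ord_p [E(K) : ℤ y_K] = 0`.
* `kolyvaginClass_one_ne_zero_of_selmerCard_eq_of_kolyvaginClass_ne_zero` — same frame: some conductor-1 datum has `c₁(1) ≠ 0`
  (a datum exists with no input, `nonempty_kolyvaginHeegnerData_one` = Darmon Thm. 3.6 proved; `c₁(1) ≠ 0 ⟺ y_K ∉ p·E(K)`,
  `kolyvaginClass_one_ne_zero_iff_heegnerPoint_not_pDiv`, p634919).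
* `selmerRankOnePinned_of_kolyvaginPrimitiveAdditive_of_published` — route level: `PUB → KPA′ → R1` with R1's REGISTERED TEXT as conclusion.

HONEST FRAMING: bookkeeping; CONDITIONAL on the displayed published inputs (no `_holds` for Gross–Zagier ∕ Kolyvagin ∕ McCallum in the tree);
no `sorry`, no new definition, standard axioms. It closes nothing: R1 itself (and KPA′) is Kolyvagin's conjecture mod `p` at an additive
prime, OPEN in print at `p² ∣ N`. BSD is not proved by any of this.

References: [cite: McCallumLMS1991, §5 Cor. 5.6 (p. 310), Lemma 5.1, §4 Cor. 4.5] [cite: GrossLMS1991, §4 (4.1), Prop. 2.3]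
[cite: SilvermanAEC2009, Thm. X.4.2] [cite: WZhang2014, Thm. 1.2, §9].
-/

set_option linter.dupNamespace false
set_option autoImplicit false

noncomputable section

open scoped Classical

namespace Summit.BirchSwinnertonDyer.BirchSwinnertonDyer.Theorems.AdditiveKoly

open WeierstrassCurve NumberField IsDedekindDomain Field
  Literature.NumberTheory.EllipticCurves Literature.NumberTheory.EllipticCurves.ModularForms
  Literature.NumberTheory.EllipticCurves.Rank1Residual Literature.NumberTheory.GaloisRepresentations
  Summit.BirchSwinnertonDyer.Rank1Residual Summit.BirchSwinnertonDyer.Rank1Residual.Additive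
  Summit.BirchSwinnertonDyer.Rank1Residual.X11b
  Summit.BirchSwinnertonDyer.BirchSwinnertonDyer.Theses.AdditiveKolyvaginRoad

/-! ## §1 One frame: a non-zero mod-`p` Kolyvagin class at `p`-Selmer rank one forces `y_K ∉ p·E(K)` -/

section Frame

variable (W : WeierstrassCurve ℚ) [W.IsElliptic] [W.IsGloballyMinimal] [NeZero (W.conductorNorm ℤ)]
  (p : ℕ) [hp : Fact p.Prime] (K : Type) [Field K] [NumberField K]
  (Dt : ModularParametrizationData W (W.conductorNorm ℤ)) (β : ℤ) (ι : K →+* ℂ)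

/-- **A finite abelian group with no non-zero `p`-torsion has order prime to `p`** (Cauchy). [folklore] -/
theorem padicValNat_card_eq_zero_of_torsion_eq_zero {A : Type*} [AddCommGroup A] [Finite A]
    (h : ∀ x : A, (p : ℤ) • x = 0 → x = 0) : padicValNat p (Nat.card A) = 0 := by
  refine padicValNat.eq_zero_of_not_dvd fun hdvd ↦ ?_
  obtain ⟨x, hx⟩ := exists_prime_addOrderOf_dvd_card' (G := A) p hdvd
  have hx0 : x = 0 := h x (by rw [natCast_zsmul, ← hx]; exact addOrderOf_nsmul_eq_zero x)
  rw [hx0, addOrderOf_zero] at hx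
  exact hp.out.ne_one hx.symm

/-- **At `p`-Selmer rank one, a non-zero mod-`p` Kolyvagin class makes the Heegner point `p`-indivisible** (one ♯ frame; published
inputs Gross–Zagier `hGZ`, Kolyvagin `hKo`, modularity `hmod`, McCallum's Cor. 5.6 certificate half `hMcC` displayed). If
`#Sel_p(E/K) = p` and some Kolyvagin–Heegner datum of Kolyvagin-prime support has `c₁(n) ≠ 0`, then no `Q ∈ E(K)` has `p·Q = y_K`
for the frame's Heegner point `y_K` (`y_K ↦ φ(τ_H)`, `H.β = β`). Proof: Heegner-index lower bound from the certificate
(`indexLowerBoundAt_of_exists_kolyvaginClass_ne_zero`) + `Ш(E/K)[p] = 0` from the exact descent count at rank one with `E(K)[p] = 0`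
(`sha_torsion_eq_zero_of_natCard_selmerGroup_eq`) + `p ∤ ∏ c_ℓ` ⟹ `ord_p [E(K) : ℤ y_K] = 0` ⟹ `y_K ∉ p·E(K)`
(`Additive.zsmul_certificate_of_padicValNat_index`). CONDITIONAL on the four named facts.
[cite: McCallumLMS1991, §5 Cor. 5.6, Lemma 5.1] [cite: SilvermanAEC2009, Thm. X.4.2] [cite: GrossLMS1991, Prop. 2.3] -/
theorem heegnerPoint_not_pDiv_of_selmerCard_eq_of_kolyvaginClass_ne_zero
    (hGZ : gross_zagier (W.conductorNorm ℤ) W K) (hKo : kolyvagin (W.conductorNorm ℤ) W K)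
    (hmod : hasEntireLFunction_rat) (hMcC : McCallum1991_pow_dvd_card_sha_primary_of_certificate)
    (hp5 : 5 ≤ p) (hs : W.HasSurjectiveModNGaloisRep p) (hCM : ¬ W.HasCM) (hr : W.analyticRank = 1)
    (htam : ¬ p ∣ W.tamagawaProduct)
    (hK : IsImaginaryQuadratic K) (hlt : NumberField.discr K < -4)
    (hH : SatisfiesHeegnerHypothesis (W.conductorNorm ℤ) K)
    (hL : (W.quadraticTwist (NumberField.discr K : ℚ)).entireLFunction 1 ≠ 0)
    (hβ : (4 * (W.conductorNorm ℤ : ℤ)) ∣ β ^ 2 - NumberField.discr K)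
    (hSel : Nat.card (WeierstrassCurve.selmerGroup (W.baseChange K) (p : ℤ)) = p)
    (hprim : ∃ (n : ℕ) (d : KolyvaginHeegnerData Dt β ι n),
      KolyvaginDescent.KolSupp (Zhang2014.IsKolyvaginPrime (W.conductorNorm ℤ) W K p) n ∧
        d.kolyvaginClass hp.out 1 ≠ 0)
    (H : HeegnerDatum (W.conductorNorm ℤ) (NumberField.discr K)) (P : (W.baseChange K).toAffine.Point)
    (hHβ : H.β = β) (hP : WeierstrassCurve.Affine.Point.map ι.toRatAlgHom P = heegnerPointComplex Dt H) :
    ¬ ∃ Q : (W.baseChange K).toAffine.Point, (p : ℤ) • Q = P := by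
  have hpP : p.Prime := hp.out
  -- the Heegner-index lower bound at `P` from the non-zero class (McCallum's certificate half)
  have hILB := indexLowerBoundAt_of_exists_kolyvaginClass_ne_zero W p K Dt β ι hGZ hKo hmod hMcC hp5 hs hCM hr hK hlt
    hH hL hβ hprim H P hHβ hP
  -- `y_K` non-torsion (Gross–Zagier), rank one and `Ш(E/K)` finite (Kolyvagin), `E(K)[p] = 0` (`ρ̄` onto)
  have hHP : IsHeegnerPoint (W.conductorNorm ℤ) W K P := ⟨Dt, H, ι, hP⟩
  have hPinf : ¬ IsOfFinAddOrder P :=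
    not_isOfFinAddOrder_of_heegner_of_analyticRank_eq_one W (W.conductorNorm ℤ) K Dt H ι P hGZ hmod hr hK hH hL hP
  obtain ⟨hrank, hSha⟩ := hKo hK hH hHP hPinf
  haveI : Finite (W.baseChange K).sha := hSha
  have hirr : W.HasIrreducibleModPGaloisRep p := hasIrreducibleModPGaloisRep_of_hasSurjectiveModNGaloisRep W p hs
  have hbot := torsionBy_eq_bot_of_isImaginaryQuadratic_of_hasIrreducibleModPGaloisRep W K hK hpP hirr
  -- `Ш(E/K)[p] = 0`: the descent count `#Sel_p = p^{rank} · #E(K)[p] · #Ш[p]` is exact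
  have hcount : Nat.card ((W.baseChange K).selmerGroup p) =
      p ^ (W.baseChange K).mordellWeilRank *
        Nat.card (AddSubgroup.torsionBy (W.baseChange K).toAffine.Point (p : ℤ)) := by
    rw [hrank, pow_one, hbot, AddSubgroup.card_bot, mul_one]
    exact hSel
  have hSha0 : ∀ x : (W.baseChange K).sha, (p : ℤ) • x = 0 → x = 0 :=
    (W.baseChange K).sha_torsion_eq_zero_of_natCard_selmerGroup_eq hpP.ne_zero hcount
  have hval : padicValNat p (W.baseChange K).shaOrder = 0 := by
    rw [WeierstrassCurve.shaOrder]
    exact padicValNat_card_eq_zero_of_torsion_eq_zero p hSha0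
  have h0 : padicValNat p W.tamagawaProduct = 0 := padicValNat.eq_zero_of_not_dvd htam
  -- hence `M₀ = ord_p [E(K) : ℤ y_K] = 0`
  have hM₀ : padicValNat p (AddSubgroup.zmultiples P).index = 0 := by
    unfold X11b.IndexLowerBoundAt at hILB
    rw [hval, h0] at hILB
    omega
  -- and `y_K` is not `p`-divisible in `E(K)`
  have hA : ∀ a : (W.baseChange K).toAffine.Point, (p : ℤ) • a = 0 → a = 0 := by
    intro a ha
    have hmem : a ∈ AddSubgroup.torsionBy (W.baseChange K).toAffine.Point (p : ℤ) :=
      (KolyvaginCocycle.mem_torsionBy_iff' (p : ℤ) a).mpr ha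
    rw [hbot] at hmem
    exact (AddSubgroup.mem_bot).mp hmem
  have hidx : (AddSubgroup.zmultiples P).index ≠ 0 :=
    index_zmultiples_ne_zero_of_isHeegnerPoint (W.conductorNorm ℤ) W K hKo hK hH hHP hPinf
  obtain ⟨-, hndiv⟩ := Additive.zsmul_certificate_of_padicValNat_index hpP hA hPinf hidx hM₀
  simpa only [zero_add, pow_one] using hndiv

/-- **At `p`-Selmer rank one, a non-zero mod-`p` Kolyvagin class at SOME Kolyvagin level gives one at level `1`** (one ♯ frame, same
published inputs). A conductor-1 datum exists with no input (`nonempty_kolyvaginHeegnerData_one`, Darmon Thm. 3.6 proved) and its class is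
non-zero iff `y_K ∉ p·E(K)` (`kolyvaginClass_one_ne_zero_iff_heegnerPoint_not_pDiv`); conclude by
`heegnerPoint_not_pDiv_of_selmerCard_eq_of_kolyvaginClass_ne_zero`. CONDITIONAL on the four named facts.
[cite: McCallumLMS1991, §4 Cor. 4.5, §5 Cor. 5.6] [cite: GrossLMS1991, §4 (P_1 = y_K)] -/
theorem kolyvaginClass_one_ne_zero_of_selmerCard_eq_of_kolyvaginClass_ne_zero
    (hGZ : gross_zagier (W.conductorNorm ℤ) W K) (hKo : kolyvagin (W.conductorNorm ℤ) W K)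
    (hmod : hasEntireLFunction_rat) (hMcC : McCallum1991_pow_dvd_card_sha_primary_of_certificate)
    (hp5 : 5 ≤ p) (hs : W.HasSurjectiveModNGaloisRep p) (hCM : ¬ W.HasCM) (hr : W.analyticRank = 1)
    (htam : ¬ p ∣ W.tamagawaProduct)
    (hK : IsImaginaryQuadratic K) (hlt : NumberField.discr K < -4)
    (hH : SatisfiesHeegnerHypothesis (W.conductorNorm ℤ) K)
    (hL : (W.quadraticTwist (NumberField.discr K : ℚ)).entireLFunction 1 ≠ 0)
    (hβ : (4 * (W.conductorNorm ℤ : ℤ)) ∣ β ^ 2 - NumberField.discr K)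
    (hSel : Nat.card (WeierstrassCurve.selmerGroup (W.baseChange K) (p : ℤ)) = p)
    (hprim : ∃ (n : ℕ) (d : KolyvaginHeegnerData Dt β ι n),
      KolyvaginDescent.KolSupp (Zhang2014.IsKolyvaginPrime (W.conductorNorm ℤ) W K p) n ∧
        d.kolyvaginClass hp.out 1 ≠ 0) :
    ∃ d₁ : KolyvaginHeegnerData Dt β ι 1, d₁.kolyvaginClass hp.out 1 ≠ 0 := by
  obtain ⟨H, hHβ⟩ := exists_heegnerDatum (W.conductorNorm ℤ) hK.discr_neg hβ
  obtain ⟨P, hP⟩ := heegnerPointComplex_mem_range_map_holds (W.conductorNorm ℤ) W K hK hH Dt H ι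
  have hnd := heegnerPoint_not_pDiv_of_selmerCard_eq_of_kolyvaginClass_ne_zero W p K Dt β ι hGZ hKo hmod hMcC hp5 hs hCM
    hr htam hK hlt hH hL hβ hSel hprim H P hHβ hP
  obtain ⟨d₁⟩ := nonempty_kolyvaginHeegnerData_one W K Dt β ι hK hβ
  exact ⟨d₁, (kolyvaginClass_one_ne_zero_iff_heegnerPoint_not_pDiv W p K Dt β ι hp5 hs hK hlt hH d₁ H hHβ P hP).mpr hnd⟩

end Frame

/-! ## §2 Route level: `PUB → KPA′ → R1` with the registered text of R1 as conclusion -/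

/-- **THE PINNED RANK-ONE STUB FROM THE CRUX, modulo the published inputs.** With `PublishedInputsAdditiveKoly` (item 20137: only
Gross–Zagier, Kolyvagin, modularity and McCallum's certificate half are used) and the crux `KolyvaginPrimitiveAdditive` (KPA′, item 21400)
as hypotheses, the REGISTERED TEXT of stub R1 `stub_selmerRankOnePinnedAdditive` of skeleton `birth` v11 holds: at every ♯ additive frame
with `#Sel_p(E/K) = p`, some conductor-1 Kolyvagin–Heegner datum has `c₁(1) ≠ 0` (`¬CM` from a multiplicative prime, ♠(2)). So R1 is
not stronger than the crux modulo PUB, and v11's split `KPA′ ⟸ P ∧ R1 ∧ R3` is exact modulo PUB. CONDITIONAL (both antecedents are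
hypotheses: PUB is published-not-proved, KPA′ is OPEN research); closes nothing. [cite: WZhang2014, Thm. 1.2, §9]
[cite: McCallumLMS1991, §5 Cor. 5.6] -/
theorem selmerRankOnePinned_of_kolyvaginPrimitiveAdditive_of_published (hPub : PublishedInputsAdditiveKoly)
    (hKPA : KolyvaginPrimitiveAdditive) :
    ∀ (W : WeierstrassCurve ℚ) [W.IsElliptic] [W.IsGloballyMinimal] [NeZero (W.conductorNorm ℤ)]
      (p : ℕ) [Fact p.Prime] (K : Type) [Field K] [NumberField K]
      (Dt : ModularParametrizationData W (W.conductorNorm ℤ)) (β : ℤ) (ι : K →+* ℂ),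
      5 ≤ p → Addv W p → W.HasSurjectiveModNGaloisRep p →
      (∀ (ℓ : ℕ) [Fact ℓ.Prime], W.HasMultiplicativeReductionAtPrime ℓ →
        ¬ p ∣ padicValInt ℓ W.minimalDiscriminantInt) →
      (∃ (ℓ₁ ℓ₂ : ℕ) (_ : Fact ℓ₁.Prime) (_ : Fact ℓ₂.Prime), ℓ₁ ≠ ℓ₂ ∧
        W.HasMultiplicativeReductionAtPrime ℓ₁ ∧ W.HasMultiplicativeReductionAtPrime ℓ₂) →
      ¬ p ∣ W.tamagawaProduct → W.analyticRank = 1 →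
      IsImaginaryQuadratic K → Odd (NumberField.discr K) → NumberField.discr K < -4 →
      SatisfiesHeegnerHypothesis (W.conductorNorm ℤ) K →
      (W.quadraticTwist (NumberField.discr K : ℚ)).entireLFunction 1 ≠ 0 →
      (4 * (W.conductorNorm ℤ : ℤ)) ∣ β ^ 2 - NumberField.discr K → ¬ (p : ℤ) ∣ Dt.c →
      Nat.card (WeierstrassCurve.selmerGroup (W.baseChange K) (p : ℤ)) = p →
      ∃ d₁ : KolyvaginHeegnerData Dt β ι 1, d₁.kolyvaginClass (Fact.out : p.Prime) 1 ≠ 0 := by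
  intro W _ _ _ p _ K _ _ Dt β ι hp5 hadd hs hsp htwo htam hr hK hodd hlt hH hL hβ hc hSel
  obtain ⟨hGZ, hKo, -, -, hmod, -, -, -, hMcC, -⟩ := hPub
  obtain ⟨ℓ₁, ℓ₂, hℓ₁, hℓ₂, hne, hm₁, hm₂⟩ := htwo
  have hCM : ¬ W.HasCM := not_hasCM_of_hasMultiplicativeReductionAtPrime' W hm₁
  have hprim := hKPA W p K Dt β ι hp5 hadd hs hsp ⟨ℓ₁, ℓ₂, hℓ₁, hℓ₂, hne, hm₁, hm₂⟩ htam hr hK hodd hlt hH hL hβ hc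
  exact kolyvaginClass_one_ne_zero_of_selmerCard_eq_of_kolyvaginClass_ne_zero W p K Dt β ι (hGZ _ W K) (hKo _ W K) hmod
    hMcC hp5 hs hCM hr htam hK hlt hH hL hβ hSel hprim

end Summit.BirchSwinnertonDyer.BirchSwinnertonDyer.Theorems.AdditiveKoly

end
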